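import Summits.ValiantsHypothesis.ValiantsHypothesis.Theorems.LacunarySymmetroidMatrixDescartesCensusTropicalKLawSlopes

/-!
# Route «KPlusLogSqLaw», crux `TropicalB` (stmt-ValiantsHypothesis-19771) — the QUASI-POLYNOMIAL BALANCED DOUBLING LAW already
# gives the registered attack foothold `stub_tropTowerLog` (`T(K·⌊log₂ K⌋, K) ≤ 2^{C·K}`): a CONDITIONAL composition

HONEST FRAMING.  Helper toward the registered stubs of `Cruxes/TropicalB/Lines/birth.lean` (crux
`Summit.ValiantsHypothesis.ValiantsHypothesis.Theses.KPlusLogSqLaw.TropicalB`, item stmt-ValiantsHypothesis-19771, route KPlusLogSqLaw,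
DRAFT; cell `pub-symmetroid`, seat val-sym-trop-p1 g12, 2026-08-27; `--supports … --as helper`).  It proves an IMPLICATION between two
statements that are OPEN — the desk's proof target of record `TowerLogOfDoublingQuasi` (lead ruling R1545 (Q1)(iii), 2026-08-26; typed as
`def TowerLogOfDoublingQuasi : Prop := DoublingQuasi → TowerLog` in conjb-2 g7's `Sketch_g7.lean`, statements only).  The hypothesis (the
quasi-polynomial doubling law) is stated INLINE and is NOT claimed; nothing here asserts `TropicalB`, the foothold, `WeakLifting`,
`KPlusLogSqLaw`, anything on DoorA26 / DoorA34, `MatrixDescartes` (stmt-ValiantsHypothesis-18050) or VP ≠ VNP.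

THE HYPOTHESIS (conjb-2 g7 `DoublingQuasi`, signed currency `TropicalCensus.TropRootLawAt ≡ TropRow` of the birth file, `Iff.rfl`): for some
`c` and all balanced splits `a + e` (`a ≤ e ≤ a + 1`) with BOTH halves of size `≥ K`,
  `TropRootLawAt a K B₁ → TropRootLawAt e K B₂ → TropRootLawAt (a + e) K (2^(c·⌊log₂(a+e)⌋² + c) · (B₁ + B₂ + 2))`
— val-sym-trop-p2 g3's balanced doubling law (`Doubling.tropicalB_of_doubling_ge`, this directory; registered as the line
`Cruxes/TropicalB/Lines/doubling.lean`, stub `stub_signedDoubling`, with the POLYNOMIAL interface loss `(a+e)^c`) with the loss RELAXED to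
a quasi-polynomial `2^(c·log²(a+e) + c)`.  The relaxed law is NOT known to follow from `TropicalB` and does NOT give `TropicalB` back by the
dyadic induction (`⌊log₂ m⌋` levels at `2^{O(log² m)}` each is `2^{O(log³ m)}`).

THE THEOREM.  It still gives the FIRST OPEN TOWER HEIGHT, because only `⌊log₂ ⌊log₂ K⌋⌋ + 1` halving levels separate the log tower
`m = K·⌊log₂ K⌋` from the fat cone `m ≤ 4K`, where slope counting gives `2^{5K}` (`tropRootLawAt_fatCone`, the signed twin of `Doubling.tropRowD_small`):
* `DoublingQuasi.tropRootLawAt_fatCone` — `m ≤ 4K → TropRootLawAt m K (2^(5K))` (slope counting);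
* `DoublingQuasi.tropRootLawAt_levels` — under the law with exponent `c`: every size `s ≤ K·2^(t+1)` with `s ≤ m` has
  `TropRootLawAt s K (2^(5K + t·(c·Λ + c + 2)))` for any `Λ ≥ ⌊log₂ m⌋²` (induction on `t`; base = the fat cone);
* `DoublingQuasi.cube_le_four_mul_two_pow` — `L³ ≤ 4·2^L` (arithmetic);
* `DoublingQuasi.towerLog_of_doublingQuasi` — **the law with exponent `c` implies `∀ K, TropRootLawAt (K·⌊log₂ K⌋) K (2^((40c+13)·K))`**,
  and `towerLog_of_doublingQuasi_exists` — the `∃ c`-form implies `∃ C, ∀ K, TropRootLawAt (K * Nat.log 2 K) K (2 ^ (C * K))`, which is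
  the registered signature of `stub_tropTowerLog` up to the definitional unfolding `TropRow = TropRootLawAt` (so a skeleton deriving the
  foothold from a `stub_tropDoublingQuasi` is the term `towerLog_of_doublingQuasi_exists stub_tropDoublingQuasi`).
Budget bookkeeping: `5K + ⌊log₂ L⌋·(c·⌊log₂(KL)⌋² + c + 2) ≤ 5K + L·(9cL² + c + 2) ≤ 5K + (10c+2)·L³ ≤ (40c+13)·K` with `L = ⌊log₂ K⌋ ≥ 1`
(`⌊log₂(KL)⌋ ≤ 2L + 1`, `L³ ≤ 4·2^L ≤ 4K`); `K ≤ 1` gives `m = 0 ≤ 4K`.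

[folklore: Gusfield's dyadic recursion (D. Gusfield, Sensitivity analysis for combinatorial optimization, PhD thesis, UC Berkeley 1980; cf.
`Literature.Combinatorics.Optimization.GusfieldBreakpointUpperBound`); the packaging and the target are the cell's (conjb-2 g7 ROUND1e memo §3).]
-/

-- `Summit.ValiantsHypothesis.ValiantsHypothesis.…` repeats a component by the D-0017 layout
-- (single-conjunct summit), which the `dupNamespace` linter flags; the name is mandated.
set_option linter.dupNamespace false
set_option autoImplicit false

namespace Summit.ValiantsHypothesis.ValiantsHypothesis.Theorems.KPlusLogSqLaw

open Summit.ValiantsHypothesis.ValiantsHypothesis.Theorems.LacunarySymmetroidMatrixDescartes.TropicalCensus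

namespace DoublingQuasi

variable {c : ℕ}

/-! ## 1. Dyadic induction from the fat cone -/

/-- slope counting on the fat cone `m ≤ 4K`: `T(m, K) ≤ 2^{5K}` (signed twin of `Doubling.tropRowD_small`). [folklore] -/
theorem tropRootLawAt_fatCone {m K : ℕ} (hm : m ≤ 4 * K) : TropRootLawAt m K (2 ^ (5 * K)) := by
  refine tropRootLawAt_mono ?_ (tropRootLawAt_choose m K)
  calc (K + m - 1).choose m - 1 ≤ (K + m - 1).choose m := Nat.sub_le _ _
    _ ≤ 2 ^ (K + m - 1) := Nat.choose_le_two_pow _ _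
    _ ≤ 2 ^ (5 * K) := Nat.pow_le_pow_right (by norm_num) (by omega)

/-- **Levels.**  Under the quasi-polynomial balanced doubling law with exponent `c` (asked only for halves of size `≥ K`): for every
ceiling `m`, every `Λ ≥ ⌊log₂ m⌋²` and every `t`, all sizes `s ≤ K·2^(t+1)` with `s ≤ m` satisfy
`TropRootLawAt s K (2^(5K + t·(c·Λ + c + 2)))`.  Base `t = 0`: `s ≤ 2K ≤ 4K`, slope counting (`tropRootLawAt_fatCone`); step: a size
`s > K·2^(t+1) ≥ 2K` splits as `⌊s/2⌋ + ⌈s/2⌉` with both halves in `[K, K·2^(t+1)]`, and `2^(c·⌊log₂ s⌋² + c)·(2G + 2) ≤ 2^(c·Λ + c + 2)·G`.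
[folklore: Gusfield's dyadic recursion] -/
theorem tropRootLawAt_levels
    (hD : ∀ (K a e B₁ B₂ : ℕ), K ≤ a → a ≤ e → e ≤ a + 1 → TropRootLawAt a K B₁ → TropRootLawAt e K B₂ →
      TropRootLawAt (a + e) K (2 ^ (c * Nat.log 2 (a + e) ^ 2 + c) * (B₁ + B₂ + 2)))
    (K m Λ : ℕ) (hΛ : Nat.log 2 m ^ 2 ≤ Λ) :
    ∀ t s : ℕ, s ≤ K * 2 ^ (t + 1) → s ≤ m → TropRootLawAt s K (2 ^ (5 * K + t * (c * Λ + c + 2))) := by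
  intro t
  induction t with
  | zero =>
    intro s hs _
    have hs4 : s ≤ 4 * K := by omega
    simpa using tropRootLawAt_fatCone hs4
  | succ t ih =>
    intro s hs hsm
    by_cases hsmall : s ≤ K * 2 ^ (t + 1)
    · refine tropRootLawAt_mono (Nat.pow_le_pow_right (by norm_num) ?_) (ih s hsmall hsm)
      exact Nat.add_le_add_left (Nat.mul_le_mul_right _ (Nat.le_succ t)) _
    · push Not at hsmall
      -- the balanced split `s = a + e`, `a = ⌊s/2⌋`
      set a := s / 2 with ha
      set e := s - s / 2 with he
      have hse : s = a + e := by omega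
      have h2K : 2 * K ≤ K * 2 ^ (t + 1) := by
        have : 2 ≤ 2 ^ (t + 1) := by
          calc 2 = 2 ^ 1 := (pow_one 2).symm
            _ ≤ 2 ^ (t + 1) := Nat.pow_le_pow_right (by norm_num) (by omega)
        nlinarith
      have hKa : K ≤ a := by omega
      have hae : a ≤ e := by omega
      have hea : e ≤ a + 1 := by omega
      have hdouble : K * 2 ^ (t + 1 + 1) = 2 * (K * 2 ^ (t + 1)) := by ring
      have ha' : a ≤ K * 2 ^ (t + 1) := by omega
      have he' : e ≤ K * 2 ^ (t + 1) := by omega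
      have ham : a ≤ m := by omega
      have hem : e ≤ m := by omega
      have h := hD K a e _ _ hKa hae hea (ih a ha' ham) (ih e he' hem)
      rw [← hse] at h
      refine tropRootLawAt_mono ?_ h
      -- budget: `2^(c·⌊log₂ s⌋² + c)·(G + G + 2) ≤ 2^(5K + (t+1)·(cΛ + c + 2))`
      set G := 2 ^ (5 * K + t * (c * Λ + c + 2)) with hG
      have hG1 : 1 ≤ G := Nat.one_le_two_pow
      have hlog : Nat.log 2 s ^ 2 ≤ Λ :=
        (Nat.pow_le_pow_left (Nat.log_mono_right hsm) 2).trans hΛ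
      have hpow : 2 ^ (c * Nat.log 2 s ^ 2 + c) ≤ 2 ^ (c * Λ + c) :=
        Nat.pow_le_pow_right (by norm_num) (Nat.add_le_add_right (Nat.mul_le_mul_left c hlog) c)
      calc 2 ^ (c * Nat.log 2 s ^ 2 + c) * (G + G + 2)
          ≤ 2 ^ (c * Λ + c) * (2 ^ 2 * G) := Nat.mul_le_mul hpow (by omega)
        _ = 2 ^ (5 * K + (t + 1) * (c * Λ + c + 2)) := by
            rw [hG, ← pow_add, ← pow_add]; ring_nf

/-! ## 2. Arithmetic of the log tower -/

/-- `L³ ≤ 4·2^L` for every `L` (equality at `L = 4`). [folklore] -/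
theorem cube_le_four_mul_two_pow (L : ℕ) : L ^ 3 ≤ 4 * 2 ^ L := by
  rcases Nat.lt_or_ge L 4 with h | h
  · interval_cases L <;> norm_num
  · induction L, h using Nat.le_induction with
    | base => norm_num
    | succ L hL ih =>
      have h1 : (L + 1) ^ 3 ≤ 2 * L ^ 3 := by
        have h4 : 4 * L ^ 2 ≤ L ^ 3 := by
          calc 4 * L ^ 2 ≤ L * L ^ 2 := Nat.mul_le_mul_right _ hL
            _ = L ^ 3 := by ring
        have h5 : 4 * L ≤ L ^ 2 := by
          calc 4 * L ≤ L * L := Nat.mul_le_mul_right _ hL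
            _ = L ^ 2 := by ring
        nlinarith
      calc (L + 1) ^ 3 ≤ 2 * L ^ 3 := h1
        _ ≤ 2 * (4 * 2 ^ L) := Nat.mul_le_mul_left 2 ih
        _ = 4 * 2 ^ (L + 1) := by ring

/-- `⌊log₂ (K·L)⌋ ≤ 2L + 1` for `L = ⌊log₂ K⌋`. [folklore] -/
theorem log_mul_log_le (K : ℕ) : Nat.log 2 (K * Nat.log 2 K) ≤ 2 * Nat.log 2 K + 1 := by
  set L := Nat.log 2 K with hL
  rcases Nat.eq_zero_or_pos (K * L) with h0 | hpos
  · rw [h0, Nat.log_zero_right]; exact Nat.zero_le _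
  · have hK : K < 2 ^ (L + 1) := hL ▸ Nat.lt_pow_succ_log_self (by norm_num) K
    have hLK : L ≤ K := hL ▸ Nat.log_le_self 2 K
    have hlt : K * L < 2 ^ (2 * L + 1 + 1) := by
      calc K * L ≤ K * K := Nat.mul_le_mul_left K hLK
        _ < 2 ^ (L + 1) * 2 ^ (L + 1) := Nat.mul_lt_mul'' hK hK
        _ = 2 ^ (2 * L + 1 + 1) := by rw [← pow_add]; ring_nf
    exact Nat.lt_succ_iff.mp (Nat.log_lt_of_lt_pow (Nat.pos_iff_ne_zero.mp hpos) hlt)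

/-- the budget of the log tower: `5K + ⌊log₂ L⌋·(c·⌊log₂(KL)⌋² + c + 2) ≤ (40c + 13)·K` for `L = ⌊log₂ K⌋ ≥ 1`. [arithmetic] -/
theorem tower_budget (c K : ℕ) (hL : 1 ≤ Nat.log 2 K) :
    5 * K + Nat.log 2 (Nat.log 2 K) * (c * Nat.log 2 (K * Nat.log 2 K) ^ 2 + c + 2) ≤ (40 * c + 13) * K := by
  set L := Nat.log 2 K with hLdef
  have hK0 : K ≠ 0 := by
    rintro rfl
    rw [hLdef, Nat.log_zero_right] at hL
    exact absurd hL (by norm_num)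
  -- `L³ ≤ 4·2^L ≤ 4K`
  have hL3 : L ^ 3 ≤ 4 * K :=
    (cube_le_four_mul_two_pow L).trans (Nat.mul_le_mul_left 4 (hLdef ▸ Nat.pow_log_le_self 2 hK0))
  -- `⌊log₂ L⌋ ≤ L`, `⌊log₂ (K L)⌋² ≤ (2L+1)² ≤ 9 L²`
  have ht : Nat.log 2 L ≤ L := Nat.log_le_self 2 L
  have hΛ : Nat.log 2 (K * L) ^ 2 ≤ 9 * L ^ 2 := by
    have h1 : Nat.log 2 (K * L) ≤ 2 * L + 1 := hLdef ▸ log_mul_log_le K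
    calc Nat.log 2 (K * L) ^ 2 ≤ (2 * L + 1) ^ 2 := Nat.pow_le_pow_left h1 2
      _ ≤ 9 * L ^ 2 := by nlinarith
  have hinner : c * Nat.log 2 (K * L) ^ 2 + c + 2 ≤ (10 * c + 2) * L ^ 2 := by
    have hL2 : 1 ≤ L ^ 2 := Nat.one_le_pow _ _ hL
    nlinarith
  calc 5 * K + Nat.log 2 L * (c * Nat.log 2 (K * L) ^ 2 + c + 2)
      ≤ 5 * K + L * ((10 * c + 2) * L ^ 2) := Nat.add_le_add_left (Nat.mul_le_mul ht hinner) _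
    _ = 5 * K + (10 * c + 2) * L ^ 3 := by ring
    _ ≤ 5 * K + (10 * c + 2) * (4 * K) := Nat.add_le_add_left (Nat.mul_le_mul_left _ hL3) _
    _ = (40 * c + 13) * K := by ring

/-! ## 3. The foothold from the quasi-polynomial doubling law -/

/-- **THE QUASI-POLYNOMIAL BALANCED DOUBLING LAW (exponent `c`, halves of size `≥ K`) IMPLIES THE LOG-TOWER FOOTHOLD**
`T(K·⌊log₂ K⌋, K) ≤ 2^((40c+13)·K)` for every `K`.  The hypothesis is NOT claimed (module docstring). [folklore: Gusfield's dyadic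
recursion; target `TowerLogOfDoublingQuasi` of the cell] -/
theorem towerLog_of_doublingQuasi
    (hD : ∀ (K a e B₁ B₂ : ℕ), K ≤ a → a ≤ e → e ≤ a + 1 → TropRootLawAt a K B₁ → TropRootLawAt e K B₂ →
      TropRootLawAt (a + e) K (2 ^ (c * Nat.log 2 (a + e) ^ 2 + c) * (B₁ + B₂ + 2)))
    (K : ℕ) : TropRootLawAt (K * Nat.log 2 K) K (2 ^ ((40 * c + 13) * K)) := by
  set L := Nat.log 2 K with hL
  rcases Nat.eq_zero_or_pos L with hL0 | hLpos
  · -- `K ≤ 1`: the format has `m = 0 ≤ 4K` rows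
    rw [hL0, Nat.mul_zero]
    refine tropRootLawAt_mono ?_ (tropRootLawAt_fatCone (Nat.zero_le (4 * K)))
    exact Nat.pow_le_pow_right (by norm_num) (by nlinarith)
  · -- `L ≥ 1`: `⌊log₂ L⌋ + 1` levels above the fat cone
    set m := K * L with hm
    have hlevel : m ≤ K * 2 ^ (Nat.log 2 L + 1) :=
      Nat.mul_le_mul_left K (Nat.lt_pow_succ_log_self (by norm_num) L).le
    have key := tropRootLawAt_levels hD K m (Nat.log 2 m ^ 2) le_rfl (Nat.log 2 L) m hlevel le_rfl
    refine tropRootLawAt_mono (Nat.pow_le_pow_right (by norm_num) ?_) key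
    exact tower_budget c K hLpos

/-- **`DoublingQuasi → TowerLog`** in the `∃`-shapes of conjb-2 g7's `Sketch_g7.lean`: the quasi-polynomial balanced doubling law (some
exponent `c`) implies `∃ C, ∀ K, TropRootLawAt (K * Nat.log 2 K) K (2 ^ (C * K))` — the registered signature of `stub_tropTowerLog` of
`Cruxes/TropicalB/Lines/birth.lean` up to the definitional unfolding `TropRow m K B = TropRootLawAt m K B`.  Neither side is claimed.
[folklore: Gusfield's dyadic recursion; target `TowerLogOfDoublingQuasi` of the cell] -/
theorem towerLog_of_doublingQuasi_exists
    (hD : ∃ c : ℕ, ∀ (K a e B₁ B₂ : ℕ), K ≤ a → a ≤ e → e ≤ a + 1 → TropRootLawAt a K B₁ → TropRootLawAt e K B₂ →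
      TropRootLawAt (a + e) K (2 ^ (c * Nat.log 2 (a + e) ^ 2 + c) * (B₁ + B₂ + 2))) :
    ∃ C : ℕ, ∀ K : ℕ, TropRootLawAt (K * Nat.log 2 K) K (2 ^ (C * K)) := by
  obtain ⟨c, hc⟩ := hD
  exact ⟨40 * c + 13, towerLog_of_doublingQuasi hc⟩

end DoublingQuasi

end Summit.ValiantsHypothesis.ValiantsHypothesis.Theorems.KPlusLogSqLaw
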